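import Mathlib
import HarnessLib
import Literature.Probability.MarkovChains.LogSobolevConstant
import Literature.Probability.MarkovChains.LogSobolevTwoPoint
import Literature.Dynamics.Contraction.ComplexConeContractionLemma22

/-!
# The modified logarithmic Sobolev (entropy) constant `ρ₀` of a finite Markov chain and `2α ≤ ρ₀ ≤ λ` (Bobkov–Tetali 2006, Prop. 3.5–3.6)

HONEST FRAMING: exact (Metropolis-corrected) sampling algorithms for lattice gauge theory; figures
of merit are autocorrelation/cost numbers at stated couplings and volumes; no continuum-physics claim.

Conventions of `LogSobolevConstant.lean` (`dirichletForm π K f = 𝓔(f,f) = ½Σ_{x,y}π(x)K(x,y)(f(x) −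
f(y))²`, `entForm` = 𝓛, `logSobolevConst` = α with `α𝓛(f) ≤ 𝓔(f,f)`, `spectralGapR` = λ with
`λVar_π(f) ≤ 𝓔(f,f)`).  Source READ: S. G. Bobkov, P. Tetali, *Modified logarithmic Sobolev
inequalities in discrete settings*, J. Theoret. Probab. 19 (2006) 289–336 [BobkovTetali2006] (the hub
literature service's copy, pp. 290–302): eq. (1.4)–(1.5) and §3 eqs. (3.1)–(3.3), PROPOSITION 3.5 and
PROPOSITION 3.6.  In the paper's normalisation `𝓔(f,g) = ½Σ_{x,y}(f(x) − f(y))(g(x) − g(y))P(x,y)μ(x)`,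
(3.1) `λ₁Var(f) ≤ 𝓔(f,f)`, (3.2) `ρ Ent(f²) ≤ 2𝓔(f,f)` (so `ρ = 2α` for the `α` of [Saloffcoste1997] /
`LogSobolevConstant.lean`) and the MODIFIED LOG-SOBOLEV INEQUALITY (3.3) = (1.5)
`ρ₀ Ent_π(f) ≤ ½𝓔(f, log f)` over positive `f`, `Ent_π(f) = E_π f log f − E_π f log E_π f`;
"`(d/dt)D(μ_t‖π) = −𝓔(f_t, log f_t)`" (1.4) is why `ρ₀` governs the continuous-time entropy decay
`D(μ_t‖π) ≤ e^{−2ρ₀t}D(μ₀‖π)` (not formalized here: no semigroup).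

* `entropyDirichletForm π K f = 𝓔(f, log f)`, `piEnt π f = Ent_π(f)` (`= 𝓛(√f)`, `piEnt_eq_entForm_sqrt`),
  `modLogSobolevConst π K = ρ₀ := inf{½𝓔(f, log f)/Ent_π(f) : f > 0, Ent_π(f) ≠ 0}` with the API
  `modLogSobolevConst_nonneg`, `modLogSobolevConst_mul_piEnt_le` ((3.3) for every positive `f`),
  `le_modLogSobolevConst` (maximality);
* **PROPOSITION 3.6, `ρ ≤ ρ₀`**: `two_mul_logSobolevConst_le_modLogSobolevConst` — **`2α ≤ ρ₀`**, through
  the paper's pointwise inequality "`(a − b)² ≤ ½(a² − b²)log(a/b)`", here as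
  `four_mul_sq_sqrt_sub_le`: `4(√a − √b)² ≤ (a − b)(log a − log b)`, whence `4𝓔(√f,√f) ≤ 𝓔(f, log f)`
  (`four_mul_dirichletForm_sqrt_le`) and `Ent_π(f) = 𝓛(√f) ≤ 𝓔(√f,√f)/α` — the one-variable step
  `2(t−1)/(t+1) ≤ log t` is the tree's `Literature.Dynamics.Contraction.two_mul_sub_one_div_add_one_le_log`
  (imported, not restated);
* **PROPOSITION 3.5, `ρ₀ ≤ λ₁`**: `modLogSobolevConst_le_spectralGapR` — **`ρ₀ ≤ λ`**, "apply the
  inequalities (3.3)–(3.5) to functions `f/n` with `n → ∞`": here (3.3) at `1 + εg` for an admissible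
  `g` (`π(g) = 0`, `‖g‖_π = 1`, `|g| ≤ B`) with the quantitative bounds `Ent_π(1 + εg) ≥ ε²/2 − ε³B/6`
  (`mul_log_ge_taylor3` of `LogSobolevConstant.lean`) and `𝓔(1 + εg, log(1 + εg)) ≤ ε²𝓔(g,g)/(1 − εB)`
  (`(a − b)(log a − log b) ≤ (a − b)²/min(a,b)`), then `ε → 0` along `𝓝[>] 0`.
* `modLogSobolevConst_twoPoint` — the SYMMETRIC TWO-POINT SPACE (`LogSobolevTwoPoint.lean`: `α = ½`,
  `λ ≤ 𝓔(f) = 1` at `f = (1,−1)`) has **`ρ₀ = 1 = λ`** by the sandwich: the case "if the inf in the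
  definition of `ρ₀` is not achieved, then in fact `ρ₀ = λ₁`" (p. 292) / Example 3.9 with `a = b = ½`.
The remark after the proof of Prop. 3.6 — "`ρ ≤ ρ₀ ≤ λ₁` easily extends to the nonreversible Markov
setting" — is how the statements are typed: any `K ≥ 0` and positive probability vector `π`
(reversibility is not used).  Everything is PROVED (finite sums; 0 named facts).
-/

namespace Literature.Probability.MarkovChains

open Finset Matrix Filter Topology

variable {X : Type*} [Fintype X]

/-! ## Definitions -/

/-- `𝓔(f, log f) = ½ Σ_{x,y} π(x)K(x,y)(f(x) − f(y))(log f(x) − log f(y))`, the "entropy production"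
Dirichlet form of eq. (1.4) "`(d/dt)D(μ_t‖π) = −𝓔(f_t, log f_t)`". [cite: BobkovTetali2006, §1
eq. (1.4)–(1.5) and §3 (the Dirichlet form `𝓔(f,g)` of a Markov kernel)] -/
noncomputable def entropyDirichletForm (π : X → ℝ) (K : Matrix X X ℝ) (f : X → ℝ) : ℝ :=
  (1 / 2) * ∑ x, ∑ y, π x * K x y * ((f x - f y) * (Real.log (f x) - Real.log (f y)))

/-- `Ent_π(f) = E_π f log f − E_π f log E_π f`. [cite: BobkovTetali2006, §1 (before eq. (1.5))] -/
noncomputable def piEnt (π f : X → ℝ) : ℝ :=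
  ∑ x, π x * (f x * Real.log (f x)) - (∑ x, π x * f x) * Real.log (∑ x, π x * f x)

/-- **The modified logarithmic Sobolev constant** `ρ₀ = inf{½𝓔(f, log f)/Ent_π(f) : f > 0,
Ent_π(f) ≠ 0}`, the optimal constant in (3.3) `ρ₀Ent_π(f) ≤ ½𝓔(f, log f)`.
[cite: BobkovTetali2006, §3 eq. (3.3) (= §1 eq. (1.5))] -/
noncomputable def modLogSobolevConst (π : X → ℝ) (K : Matrix X X ℝ) : ℝ :=
  sInf ((fun f => (entropyDirichletForm π K f / 2) / piEnt π f) ''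
    {f : X → ℝ | (∀ x, 0 < f x) ∧ piEnt π f ≠ 0})

/-! ## `Ent_π(f) = 𝓛(√f)` and signs -/

/-- `Ent_π(f) = 𝓛(√f)` for `f ≥ 0` and `π > 0` (Miclo's "`Ent(m) = 𝓛(√f)`" in the function
normalisation). [cite: BobkovTetali2006, §3 (proof of Prop. 3.6: "Putting `a = e^{f(x)/2}`,
`b = e^{f(y)/2}`")] -/
theorem piEnt_eq_entForm_sqrt {π : X → ℝ} (hπ : ∀ x, 0 < π x) {f : X → ℝ} (hf : ∀ x, 0 ≤ f x) :
    piEnt π f = entForm π (fun x => Real.sqrt (f x)) := by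
  unfold piEnt entForm piInner
  have hsq : ∀ x, Real.sqrt (f x) ^ 2 = f x := fun x => Real.sq_sqrt (hf x)
  have hsq' : ∀ x, Real.sqrt (f x) * Real.sqrt (f x) = f x := fun x => Real.mul_self_sqrt (hf x)
  simp_rw [hsq, hsq']
  set m := ∑ x, π x * f x with hm
  have hm0 : 0 ≤ m := sum_nonneg fun x _ => mul_nonneg (hπ x).le (hf x)
  rcases hm0.eq_or_lt with h0 | hpos
  · -- `m = 0`: `f ≡ 0`
    have hz : ∀ x, f x = 0 := by
      have h := (sum_eq_zero_iff_of_nonneg (s := univ) (fun x _ => mul_nonneg (hπ x).le (hf x))).1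
        h0.symm
      intro x
      have := h x (mem_univ x)
      rcases mul_eq_zero.1 this with h1 | h1
      · exact absurd h1 (hπ x).ne'
      · exact h1
    simp [hz, ← h0]
  · have key : ∀ x, π x * (f x * Real.log (f x / m))
        = π x * (f x * Real.log (f x)) - Real.log m * (π x * f x) := by
      intro x
      rcases (hf x).eq_or_lt with hfx | hfx
      · rw [← hfx]; simp
      · rw [Real.log_div hfx.ne' hpos.ne']; ring
    simp_rw [key]
    rw [sum_sub_distrib, ← mul_sum, ← hm]; ring

/-- `Ent_π(f) ≥ 0` for `f ≥ 0` (probability vector `π > 0`). [cite: BobkovTetali2006, §1] -/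
theorem piEnt_nonneg {π : X → ℝ} (hπ : ∀ x, 0 < π x) (hπ1 : ∑ x, π x = 1) {f : X → ℝ}
    (hf : ∀ x, 0 ≤ f x) : 0 ≤ piEnt π f := by
  rw [piEnt_eq_entForm_sqrt hπ hf]; exact entForm_nonneg hπ hπ1 _

/-- `(a − b)(log a − log b) ≥ 0` for `a, b > 0`. [folklore] -/
private theorem sub_mul_log_sub_nonneg {a b : ℝ} (ha : 0 < a) (hb : 0 < b) :
    0 ≤ (a - b) * (Real.log a - Real.log b) := by
  rcases le_total a b with h | h
  · exact mul_nonneg_of_nonpos_of_nonpos (by linarith) (by linarith [Real.log_le_log ha h])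
  · exact mul_nonneg (by linarith) (by linarith [Real.log_le_log hb h])

/-- `𝓔(f, log f) ≥ 0` for positive `f`, `π ≥ 0`, `K ≥ 0`. [cite: BobkovTetali2006, §1 eq. (1.4)] -/
theorem entropyDirichletForm_nonneg {π : X → ℝ} (hπ0 : ∀ x, 0 ≤ π x) {K : Matrix X X ℝ}
    (hK : ∀ x y, 0 ≤ K x y) {f : X → ℝ} (hf : ∀ x, 0 < f x) : 0 ≤ entropyDirichletForm π K f := by
  unfold entropyDirichletForm
  refine mul_nonneg (by norm_num) (sum_nonneg fun x _ => sum_nonneg fun y _ => ?_)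
  exact mul_nonneg (mul_nonneg (hπ0 x) (hK x y)) (sub_mul_log_sub_nonneg (hf x) (hf y))

/-! ## The constant `ρ₀` -/

/-- `ρ₀ ≥ 0`. [cite: BobkovTetali2006, §3 Prop. 3.6 (`0 ≤ ρ ≤ ρ₀`)] -/
theorem modLogSobolevConst_nonneg {π : X → ℝ} (hπ : ∀ x, 0 < π x) (hπ1 : ∑ x, π x = 1)
    {K : Matrix X X ℝ} (hK : ∀ x y, 0 ≤ K x y) : 0 ≤ modLogSobolevConst π K := by
  refine Real.sInf_nonneg ?_
  rintro _ ⟨f, ⟨hf, -⟩, rfl⟩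
  exact div_nonneg (div_nonneg (entropyDirichletForm_nonneg (fun x => (hπ x).le) hK hf)
    (by norm_num)) (piEnt_nonneg hπ hπ1 fun x => (hf x).le)

/-- `ρ₀ ≤ ½𝓔(f, log f)/Ent_π(f)` for every admissible `f`. [cite: BobkovTetali2006, §3 eq. (3.3)] -/
theorem modLogSobolevConst_le_div {π : X → ℝ} (hπ : ∀ x, 0 < π x) (hπ1 : ∑ x, π x = 1)
    {K : Matrix X X ℝ} (hK : ∀ x y, 0 ≤ K x y) {f : X → ℝ} (hf : ∀ x, 0 < f x)
    (hne : piEnt π f ≠ 0) :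
    modLogSobolevConst π K ≤ (entropyDirichletForm π K f / 2) / piEnt π f :=
  csInf_le ⟨0, by
    rintro _ ⟨g, ⟨hg, -⟩, rfl⟩
    exact div_nonneg (div_nonneg (entropyDirichletForm_nonneg (fun x => (hπ x).le) hK hg)
      (by norm_num)) (piEnt_nonneg hπ hπ1 fun x => (hg x).le)⟩ ⟨f, ⟨hf, hne⟩, rfl⟩

/-- **The modified log-Sobolev inequality (3.3): `ρ₀·Ent_π(f) ≤ ½𝓔(f, log f)`** for every positive
`f`. [cite: BobkovTetali2006, §3 eq. (3.3)] -/
theorem modLogSobolevConst_mul_piEnt_le {π : X → ℝ} (hπ : ∀ x, 0 < π x) (hπ1 : ∑ x, π x = 1)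
    {K : Matrix X X ℝ} (hK : ∀ x y, 0 ≤ K x y) {f : X → ℝ} (hf : ∀ x, 0 < f x) :
    modLogSobolevConst π K * piEnt π f ≤ entropyDirichletForm π K f / 2 := by
  by_cases hne : piEnt π f = 0
  · rw [hne, mul_zero]
    exact div_nonneg (entropyDirichletForm_nonneg (fun x => (hπ x).le) hK hf) (by norm_num)
  · have hpos : 0 < piEnt π f := lt_of_le_of_ne (piEnt_nonneg hπ hπ1 fun x => (hf x).le) (Ne.symm hne)
    exact (le_div_iff₀ hpos).1 (modLogSobolevConst_le_div hπ hπ1 hK hf hne)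

/-- **`ρ₀` is the LARGEST constant in (3.3)**: if `c·Ent_π(f) ≤ ½𝓔(f, log f)` for all positive `f`
and some positive `f` has `Ent_π(f) ≠ 0`, then `c ≤ ρ₀`. [cite: BobkovTetali2006, §3 ("for the
optimal constants in (3.1)–(3.5)")] -/
theorem le_modLogSobolevConst {π : X → ℝ} (hπ : ∀ x, 0 < π x) (hπ1 : ∑ x, π x = 1)
    {K : Matrix X X ℝ} {c : ℝ}
    (hc : ∀ f : X → ℝ, (∀ x, 0 < f x) → c * piEnt π f ≤ entropyDirichletForm π K f / 2)
    (hne : ∃ f : X → ℝ, (∀ x, 0 < f x) ∧ piEnt π f ≠ 0) : c ≤ modLogSobolevConst π K := by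
  obtain ⟨f₀, hf₀, hne₀⟩ := hne
  refine le_csInf ⟨_, ⟨f₀, ⟨hf₀, hne₀⟩, rfl⟩⟩ ?_
  rintro _ ⟨f, ⟨hf, hfne⟩, rfl⟩
  have hpos : 0 < piEnt π f := lt_of_le_of_ne (piEnt_nonneg hπ hπ1 fun x => (hf x).le) (Ne.symm hfne)
  exact (le_div_iff₀ hpos).2 (hc f hf)

/-- On a space with two points (positive probability vector) some positive `f` has `Ent_π(f) ≠ 0`:
`f = (1 + 𝟙_{x₀})²` has `Ent_π(f) = 𝓛(1 + 𝟙_{x₀}) = ‖·‖²·Ent(p | π) ≥ 2‖·‖²‖p − π‖²_TV > 0`, the law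
`p ∝ π(1 + 𝟙_{x₀})²` being different from `π`. [cite: BobkovTetali2006, §3 (the infimum defining
`ρ₀` is over a nonempty class)] -/
theorem exists_pos_piEnt_ne_zero [DecidableEq X] [Nontrivial X] {π : X → ℝ} (hπ : ∀ x, 0 < π x)
    (hπ1 : ∑ x, π x = 1) : ∃ f : X → ℝ, (∀ x, 0 < f x) ∧ piEnt π f ≠ 0 := by
  obtain ⟨x₀, y₀, hxy⟩ := exists_pair_ne X
  set g : X → ℝ := fun x => if x = x₀ then 2 else 1 with hg
  have hgpos : ∀ x, 0 < g x := fun x => by simp only [hg]; split_ifs <;> norm_num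
  refine ⟨fun x => g x ^ 2, fun x => pow_pos (hgpos x) 2, ?_⟩
  rw [piEnt_eq_entForm_sqrt hπ fun x => (pow_pos (hgpos x) 2).le]
  have hs : (fun x => Real.sqrt (g x ^ 2)) = g := funext fun x => Real.sqrt_sq (hgpos x).le
  rw [hs]
  -- `𝓛(g) = ‖g‖²·Ent(p | π)` with `p = πg²/‖g‖²`, and `p ≠ π`
  set N := piInner π g g with hN
  have hN1 : N = 1 + 3 * π x₀ := by
    simp only [hN, hg]
    unfold piInner
    have e : ∀ x, π x * ((if x = x₀ then (2:ℝ) else 1) * (if x = x₀ then 2 else 1))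
        = π x + (if x = x₀ then 3 * π x₀ else 0) := by
      intro x; by_cases hx : x = x₀ <;> simp [hx]; ring
    simp_rw [e]
    rw [sum_add_distrib, hπ1, sum_ite_eq' univ x₀, if_pos (mem_univ x₀)]
  have hNpos : 0 < N := by rw [hN1]; linarith [hπ x₀]
  rw [entForm_eq_mul_relEnt (fun x => (hπ x).ne') hNpos.ne']
  set p : X → ℝ := fun x => π x * g x ^ 2 / N with hp
  have hp0 : ∀ x, 0 ≤ p x := fun x => by
    simp only [hp]; exact div_nonneg (mul_nonneg (hπ x).le (sq_nonneg _)) hNpos.le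
  have hp1 : ∑ x, p x = 1 := by
    simp only [hp]
    rw [← sum_div, div_eq_one_iff_eq hNpos.ne', hN]
    unfold piInner
    exact sum_congr rfl fun x _ => by ring
  have hPin := two_mul_tvDist_sq_le_relEnt hp0 hp1 hπ hπ1
  -- `p ≠ π`: at `x₀`, `p(x₀) = 4π(x₀)/(1 + 3π(x₀)) ≠ π(x₀)` since `π(x₀) < 1`
  have hlt : π x₀ < 1 := by
    have h2 : π x₀ + π y₀ ≤ ∑ x, π x := by
      rw [← sum_pair hxy]
      exact sum_le_sum_of_subset_of_nonneg (subset_univ _) fun x _ _ => (hπ x).le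
    linarith [hπ y₀]
  have hne : p ≠ π := by
    intro h
    have h0 := congrFun h x₀
    simp only [hp, hg, if_true] at h0
    rw [hN1, div_eq_iff (by linarith [hπ x₀])] at h0
    nlinarith [hπ x₀]
  have htv : 0 < tvDist p π := by
    rcases (tvDist_nonneg p π).eq_or_lt with h0 | h0
    · exact absurd ((tvDist_eq_zero_iff p π).1 h0.symm) hne
    · exact h0
  have : 0 < relEnt p π := lt_of_lt_of_le (by positivity) hPin
  exact (mul_pos hNpos this).ne'

/-! ## Proposition 3.6: `ρ ≤ ρ₀`, i.e. `2α ≤ ρ₀` -/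

/-- **`4(√a − √b)² ≤ (a − b)(log a − log b)`** for `a, b > 0` (the paper's
"`(a − b)² ≤ ½(a² − b²) log(a/b)`" after `a ↦ √a`). [cite: BobkovTetali2006, §3 (proof of
Prop. 3.6)] -/
theorem four_mul_sq_sqrt_sub_le {a b : ℝ} (ha : 0 < a) (hb : 0 < b) :
    4 * (Real.sqrt a - Real.sqrt b) ^ 2 ≤ (a - b) * (Real.log a - Real.log b) := by
  -- by symmetry `a ≥ b`; then with `t = √a/√b ≥ 1`: `log t ≥ 2(t−1)/(t+1)`
  wlog hab : b ≤ a generalizing a b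
  · have h := this hb ha (le_of_not_ge hab)
    have e1 : (Real.sqrt b - Real.sqrt a) ^ 2 = (Real.sqrt a - Real.sqrt b) ^ 2 := by ring
    have e2 : (b - a) * (Real.log b - Real.log a) = (a - b) * (Real.log a - Real.log b) := by ring
    rw [e1, e2] at h
    exact h
  set s := Real.sqrt a with hs
  set r := Real.sqrt b with hr
  have hs0 : 0 < s := Real.sqrt_pos.2 ha
  have hr0 : 0 < r := Real.sqrt_pos.2 hb
  have hsa : s ^ 2 = a := Real.sq_sqrt ha.le
  have hrb : r ^ 2 = b := Real.sq_sqrt hb.le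
  have hrs : r ≤ s := Real.sqrt_le_sqrt hab
  have ht : 1 ≤ s / r := by rw [le_div_iff₀ hr0]; linarith
  have hlog : Real.log a - Real.log b = 2 * Real.log (s / r) := by
    rw [← hsa, ← hrb, Real.log_pow, Real.log_pow, Real.log_div hs0.ne' hr0.ne']
    push_cast
    ring
  -- `log t ≥ 2(t − 1)/(t + 1)` for `t ≥ 1` is the tree's
  -- `Literature.Dynamics.Contraction.two_mul_sub_one_div_add_one_le_log` (reused, not restated)
  have key := Literature.Dynamics.Contraction.two_mul_sub_one_div_add_one_le_log ht
  -- `2(t−1)/(t+1) = 2(s − r)/(s + r)`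
  have e : 2 * (s / r - 1) / (s / r + 1) = 2 * (s - r) / (s + r) := by
    have hsr : s + r ≠ 0 := by linarith
    field_simp
  rw [e] at key
  rw [hlog, ← hsa, ← hrb]
  -- goal: `4(s − r)² ≤ (s² − r²)·(2 log(s/r))`, from `log(s/r) ≥ 2(s−r)/(s+r)`
  have hsr : 0 < s + r := by linarith
  have h1 : 2 * (s - r) / (s + r) * ((s ^ 2 - r ^ 2) * 2) ≤ Real.log (s / r) * ((s ^ 2 - r ^ 2) * 2) :=
    mul_le_mul_of_nonneg_right key (by nlinarith)
  have e2 : 2 * (s - r) / (s + r) * ((s ^ 2 - r ^ 2) * 2) = 4 * (s - r) ^ 2 := by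
    field_simp
    ring
  rw [e2] at h1
  linarith

/-- `4𝓔(√f, √f) ≤ 𝓔(f, log f)` for positive `f` (`π, K ≥ 0`), termwise from
`four_mul_sq_sqrt_sub_le`. [cite: BobkovTetali2006, §3 (proof of Prop. 3.6)] -/
theorem four_mul_dirichletForm_sqrt_le {π : X → ℝ} (hπ0 : ∀ x, 0 ≤ π x) {K : Matrix X X ℝ}
    (hK : ∀ x y, 0 ≤ K x y) {f : X → ℝ} (hf : ∀ x, 0 < f x) :
    4 * dirichletForm π K (fun x => Real.sqrt (f x)) ≤ entropyDirichletForm π K f := by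
  unfold dirichletForm entropyDirichletForm
  rw [← mul_assoc, show (4 : ℝ) * (1 / 2) = (1 / 2) * 4 by norm_num, mul_assoc, mul_sum]
  refine mul_le_mul_of_nonneg_left (sum_le_sum fun x _ => ?_) (by norm_num)
  rw [mul_sum]
  refine sum_le_sum fun y _ => ?_
  have h := four_mul_sq_sqrt_sub_le (hf x) (hf y)
  have hw : 0 ≤ π x * K x y := mul_nonneg (hπ0 x) (hK x y)
  calc 4 * (π x * K x y * (Real.sqrt (f x) - Real.sqrt (f y)) ^ 2)
      = π x * K x y * (4 * (Real.sqrt (f x) - Real.sqrt (f y)) ^ 2) := by ring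
    _ ≤ π x * K x y * ((f x - f y) * (Real.log (f x) - Real.log (f y))) :=
      mul_le_mul_of_nonneg_left h hw

/-- **PROPOSITION 3.6 (`ρ ≤ ρ₀`): `2α ≤ ρ₀`** — for a finite chain `K ≥ 0` with positive probability
vector `π` on at least two points, twice the logarithmic Sobolev constant is at most the modified one:
`2α·Ent_π(f) = 2α𝓛(√f) ≤ 2𝓔(√f,√f) ≤ ½𝓔(f, log f)`. [cite: BobkovTetali2006, §3 Proposition 3.6
(with the remark after its proof: the nonreversible Markov setting as well)] -/
theorem two_mul_logSobolevConst_le_modLogSobolevConst [Nontrivial X] {π : X → ℝ}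
    (hπ : ∀ x, 0 < π x) (hπ1 : ∑ x, π x = 1) {K : Matrix X X ℝ} (hK : ∀ x y, 0 ≤ K x y) :
    2 * logSobolevConst π K ≤ modLogSobolevConst π K := by
  classical
  refine le_modLogSobolevConst hπ hπ1 (fun f hf => ?_) (exists_pos_piEnt_ne_zero hπ hπ1)
  rw [piEnt_eq_entForm_sqrt hπ fun x => (hf x).le]
  have h1 := logSobolevConst_mul_entForm_le hπ hπ1 hK (fun x => Real.sqrt (f x))
  have h2 := four_mul_dirichletForm_sqrt_le (fun x => (hπ x).le) hK hf
  linarith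

/-! ## Proposition 3.5: `ρ₀ ≤ λ₁` -/

/-- `(a − b)(log a − log b) ≤ (a − b)²/m` whenever `0 < m ≤ a, b` (`|log a − log b| ≤ |a − b|/min`).
[cite: BobkovTetali2006, §3 Proposition 3.5 (proof: "apply the inequalities … to functions `f/n`
with `n → ∞`"; this is the quantitative step)] -/
theorem sub_mul_log_sub_le {a b m : ℝ} (hm : 0 < m) (ha : m ≤ a) (hb : m ≤ b) :
    (a - b) * (Real.log a - Real.log b) ≤ (a - b) ^ 2 / m := by
  have ha0 : 0 < a := lt_of_lt_of_le hm ha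
  have hb0 : 0 < b := lt_of_lt_of_le hm hb
  rw [le_div_iff₀ hm]
  rcases le_total b a with h | h
  · -- `a ≥ b`: `log a − log b = log(a/b) ≤ a/b − 1 = (a − b)/b ≤ (a − b)/m`
    have h1 : Real.log a - Real.log b ≤ (a - b) / b := by
      rw [← Real.log_div ha0.ne' hb0.ne']
      have := Real.log_le_sub_one_of_pos (div_pos ha0 hb0)
      rw [div_sub_one hb0.ne'] at this
      exact this
    have h2 : (a - b) * (Real.log a - Real.log b) ≤ (a - b) * ((a - b) / b) :=
      mul_le_mul_of_nonneg_left h1 (by linarith)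
    have h3 : (a - b) * ((a - b) / b) * m ≤ (a - b) ^ 2 := by
      rw [show (a - b) * ((a - b) / b) * m = (a - b) ^ 2 * (m / b) by
        rw [div_eq_mul_inv, div_eq_mul_inv]; ring]
      exact mul_le_of_le_one_right (sq_nonneg _) ((div_le_one hb0).2 hb)
    nlinarith [mul_le_mul_of_nonneg_right h2 hm.le]
  · have h1 : Real.log b - Real.log a ≤ (b - a) / a := by
      rw [← Real.log_div hb0.ne' ha0.ne']
      have := Real.log_le_sub_one_of_pos (div_pos hb0 ha0)
      rw [div_sub_one ha0.ne'] at this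
      exact this
    have h2 : (b - a) * (Real.log b - Real.log a) ≤ (b - a) * ((b - a) / a) :=
      mul_le_mul_of_nonneg_left h1 (by linarith)
    have h3 : (b - a) * ((b - a) / a) * m ≤ (a - b) ^ 2 := by
      rw [show (b - a) * ((b - a) / a) * m = (a - b) ^ 2 * (m / a) by
        rw [div_eq_mul_inv, div_eq_mul_inv]; ring]
      exact mul_le_of_le_one_right (sq_nonneg _) ((div_le_one ha0).2 ha)
    have e : (a - b) * (Real.log a - Real.log b) = (b - a) * (Real.log b - Real.log a) := by ring
    rw [e]
    nlinarith [mul_le_mul_of_nonneg_right h2 hm.le]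

/-- `𝓔(1 + εg, log(1 + εg)) ≤ ε²𝓔(g,g)/(1 − εB)` for `|g| ≤ B`, `0 ≤ ε`, `εB < 1` (`π, K ≥ 0`).
[cite: BobkovTetali2006, §3 Proposition 3.5 (proof, functions `f/n`)] -/
theorem entropyDirichletForm_one_add_smul_le {π : X → ℝ} (hπ0 : ∀ x, 0 ≤ π x) {K : Matrix X X ℝ}
    (hK : ∀ x y, 0 ≤ K x y) {g : X → ℝ} {B ε : ℝ} (hgB : ∀ x, |g x| ≤ B) (hε : 0 ≤ ε)
    (hεB : ε * B < 1) :
    entropyDirichletForm π K (fun x => 1 + ε * g x)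
      ≤ ε ^ 2 * dirichletForm π K g / (1 - ε * B) := by
  have hm : 0 < 1 - ε * B := by linarith
  have hlow : ∀ x, 1 - ε * B ≤ 1 + ε * g x := fun x => by
    have := neg_le_of_abs_le (hgB x)
    nlinarith
  have hterm : ∀ x y, π x * K x y * (((1 + ε * g x) - (1 + ε * g y))
      * (Real.log (1 + ε * g x) - Real.log (1 + ε * g y)))
      ≤ π x * K x y * (g x - g y) ^ 2 * (ε ^ 2 / (1 - ε * B)) := by
    intro x y
    have hw : 0 ≤ π x * K x y := mul_nonneg (hπ0 x) (hK x y)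
    have h := sub_mul_log_sub_le hm (hlow x) (hlow y)
    have e : ((1 + ε * g x) - (1 + ε * g y)) ^ 2 / (1 - ε * B)
        = (g x - g y) ^ 2 * (ε ^ 2 / (1 - ε * B)) := by
      rw [div_eq_mul_inv, div_eq_mul_inv]; ring
    rw [e] at h
    have := mul_le_mul_of_nonneg_left h hw
    linarith [this]
  unfold entropyDirichletForm dirichletForm
  beta_reduce
  calc (1 / 2) * ∑ x, ∑ y, π x * K x y * (((1 + ε * g x) - (1 + ε * g y))
        * (Real.log (1 + ε * g x) - Real.log (1 + ε * g y)))
      ≤ (1 / 2) * ∑ x, ∑ y, π x * K x y * (g x - g y) ^ 2 * (ε ^ 2 / (1 - ε * B)) :=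
        mul_le_mul_of_nonneg_left (sum_le_sum fun x _ => sum_le_sum fun y _ => hterm x y)
          (by norm_num)
    _ = ε ^ 2 * ((1 / 2) * ∑ x, ∑ y, π x * K x y * (g x - g y) ^ 2) / (1 - ε * B) := by
        have e2 : ∀ x, ∑ y, π x * K x y * (g x - g y) ^ 2 * (ε ^ 2 / (1 - ε * B))
            = (∑ y, π x * K x y * (g x - g y) ^ 2) * (ε ^ 2 / (1 - ε * B)) := fun x => by
          rw [sum_mul]
        simp_rw [e2]
        rw [← sum_mul, div_eq_mul_inv, div_eq_mul_inv]
        ring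

/-- `Ent_π(1 + εg) ≥ ε²/2 − ε³B/6` for `π(g) = 0`, `‖g‖_π = 1`, `|g| ≤ B`, `0 ≤ ε`, `εB < 1`
(third-order expansion `h log h ≥ (h−1) + (h−1)²/2 − (h−1)³/6`). [cite: BobkovTetali2006, §3
Proposition 3.5 (proof, functions `f/n`)] -/
theorem piEnt_one_add_smul_ge {π : X → ℝ} (hπ0 : ∀ x, 0 ≤ π x) (hπ1 : ∑ x, π x = 1) {g : X → ℝ}
    (hg0 : ∑ x, π x * g x = 0) (hg1 : piInner π g g = 1) {B ε : ℝ} (hgB : ∀ x, |g x| ≤ B)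
    (hε : 0 ≤ ε) (hεB : ε * B < 1) :
    ε ^ 2 / 2 - ε ^ 3 * B / 6 ≤ piEnt π (fun x => 1 + ε * g x) := by
  have hpos : ∀ x, 0 < 1 + ε * g x := fun x => by
    have := neg_le_of_abs_le (hgB x); nlinarith
  have hmean : ∑ x, π x * (1 + ε * g x) = 1 := by
    have e : ∀ x, π x * (1 + ε * g x) = π x + ε * (π x * g x) := fun x => by ring
    simp_rw [e]
    rw [sum_add_distrib, ← mul_sum, hg0, hπ1]; ring
  unfold piEnt
  rw [hmean, Real.log_one, mul_zero, sub_zero]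
  have hg2 : ∑ x, π x * g x ^ 2 = 1 := by
    rw [← hg1]; unfold piInner; exact sum_congr rfl fun x _ => by ring
  have hg3 : ∑ x, π x * g x ^ 3 ≤ B := by
    calc ∑ x, π x * g x ^ 3 ≤ ∑ x, π x * (B * g x ^ 2) := by
          refine sum_le_sum fun x _ => mul_le_mul_of_nonneg_left ?_ (hπ0 x)
          have h1 : g x ^ 3 = g x * g x ^ 2 := by ring
          rw [h1]
          exact mul_le_mul_of_nonneg_right (le_of_abs_le (hgB x)) (sq_nonneg _)
      _ = B * ∑ x, π x * g x ^ 2 := by rw [mul_sum]; exact sum_congr rfl fun x _ => by ring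
      _ = B := by rw [hg2, mul_one]
  -- termwise Taylor bound
  have key : ∀ x, π x * (ε * g x + (ε * g x) ^ 2 / 2 - (ε * g x) ^ 3 / 6)
      ≤ π x * ((1 + ε * g x) * Real.log (1 + ε * g x)) := by
    intro x
    refine mul_le_mul_of_nonneg_left ?_ (hπ0 x)
    have h := mul_log_ge_taylor3 (hpos x)
    simp only [add_sub_cancel_left] at h
    exact h
  calc ε ^ 2 / 2 - ε ^ 3 * B / 6
      ≤ ε * (∑ x, π x * g x) + ε ^ 2 / 2 * (∑ x, π x * g x ^ 2)
          - ε ^ 3 / 6 * (∑ x, π x * g x ^ 3) := by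
        rw [hg0, hg2]; nlinarith [hg3, pow_nonneg hε 3]
    _ = ∑ x, π x * (ε * g x + (ε * g x) ^ 2 / 2 - (ε * g x) ^ 3 / 6) := by
        rw [mul_sum, mul_sum, mul_sum, ← sum_add_distrib, ← sum_sub_distrib]
        exact sum_congr rfl fun x _ => by ring
    _ ≤ ∑ x, π x * ((1 + ε * g x) * Real.log (1 + ε * g x)) := sum_le_sum fun x _ => key x

/-- The perturbation step of Proposition 3.5: for an admissible `g` (`π(g) = 0`, `‖g‖_π = 1`),
**`ρ₀ ≤ 𝓔(g,g)`** (from (3.3) at `1 + εg` and `ε → 0`). [cite: BobkovTetali2006, §3 Proposition 3.5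
(proof)] -/
theorem modLogSobolevConst_le_dirichletForm {π : X → ℝ} (hπ : ∀ x, 0 < π x) (hπ1 : ∑ x, π x = 1)
    {K : Matrix X X ℝ} (hK : ∀ x y, 0 ≤ K x y) {g : X → ℝ} (hg0 : ∑ x, π x * g x = 0)
    (hg1 : piInner π g g = 1) :
    modLogSobolevConst π K ≤ dirichletForm π K g := by
  have hπ0 : ∀ x, 0 ≤ π x := fun x => (hπ x).le
  set ρ := modLogSobolevConst π K with hρ_eq
  have hρ : 0 ≤ ρ := modLogSobolevConst_nonneg hπ hπ1 hK
  have hE0 : 0 ≤ dirichletForm π K g := dirichletForm_nonneg hπ0 hK g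
  -- a uniform bound `|g| ≤ B`, `B ≥ 1`
  set B : ℝ := 1 + ∑ x, |g x| with hB
  have hB1 : 1 ≤ B := by
    have : 0 ≤ ∑ x, |g x| := sum_nonneg fun x _ => abs_nonneg _
    linarith
  have hgB : ∀ x, |g x| ≤ B := fun x => by
    have h := single_le_sum (f := fun x => |g x|) (fun x _ => abs_nonneg (g x)) (mem_univ x)
    linarith
  have hB0 : 0 < B := lt_of_lt_of_le one_pos hB1
  -- for `0 < ε < 1/B`: `ρ·(ε²/2 − ε³B/6) ≤ ρ·Ent(1+εg) ≤ ½𝓔(1+εg, log(1+εg)) ≤ ε²𝓔(g)/(2(1−εB))`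
  set φ : ℝ → ℝ := fun ε => ρ * ((1 - ε * B / 3) * (1 - ε * B)) with hφ
  have key : ∀ ε : ℝ, 0 < ε → ε < 1 / B → φ ε ≤ dirichletForm π K g := by
    intro ε hε hεB
    have hεB' : ε * B < 1 := by rwa [lt_div_iff₀ hB0] at hεB
    have hm : 0 < 1 - ε * B := by linarith
    have h1 := modLogSobolevConst_mul_piEnt_le hπ hπ1 hK (f := fun x => 1 + ε * g x)
      (fun x => by have := neg_le_of_abs_le (hgB x); nlinarith)
    have h2 := piEnt_one_add_smul_ge hπ0 hπ1 hg0 hg1 hgB hε.le hεB'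
    have h3 := entropyDirichletForm_one_add_smul_le hπ0 hK hgB hε.le hεB'
    -- `ρ(ε²/2 − ε³B/6) ≤ ε²𝓔(g)/(2(1 − εB))`
    have h4 : ρ * (ε ^ 2 / 2 - ε ^ 3 * B / 6) ≤ ε ^ 2 * dirichletForm π K g / (1 - ε * B) / 2 := by
      calc ρ * (ε ^ 2 / 2 - ε ^ 3 * B / 6) ≤ ρ * piEnt π (fun x => 1 + ε * g x) :=
            mul_le_mul_of_nonneg_left h2 hρ
        _ ≤ entropyDirichletForm π K (fun x => 1 + ε * g x) / 2 := h1
        _ ≤ ε ^ 2 * dirichletForm π K g / (1 - ε * B) / 2 := by linarith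
    -- multiply by `2(1 − εB)/ε²`
    have hε2 : 0 < ε ^ 2 := by positivity
    have h5 : ρ * (ε ^ 2 / 2 - ε ^ 3 * B / 6) * (2 * (1 - ε * B))
        ≤ ε ^ 2 * dirichletForm π K g / (1 - ε * B) / 2 * (2 * (1 - ε * B)) :=
      mul_le_mul_of_nonneg_right h4 (by linarith)
    have e1 : ρ * (ε ^ 2 / 2 - ε ^ 3 * B / 6) * (2 * (1 - ε * B)) = ε ^ 2 * φ ε := by
      simp only [hφ]; ring
    have e2 : ε ^ 2 * dirichletForm π K g / (1 - ε * B) / 2 * (2 * (1 - ε * B))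
        = ε ^ 2 * dirichletForm π K g := by
      field_simp
    rw [e1, e2] at h5
    exact le_of_mul_le_mul_left h5 hε2
  -- `φ ε → ρ` as `ε → 0⁺`
  have hcont : Continuous φ := by
    simp only [hφ]
    exact continuous_const.mul (((continuous_const.sub ((continuous_id.mul continuous_const).div_const 3)).mul
      (continuous_const.sub (continuous_id.mul continuous_const))))
  have hφ0 : φ 0 = ρ := by simp only [hφ]; ring
  have hlim : Tendsto φ (𝓝[>] 0) (𝓝 ρ) := by
    rw [← hφ0]
    exact (hcont.tendsto 0).mono_left nhdsWithin_le_nhds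
  have hev : ∀ᶠ ε in 𝓝[>] (0 : ℝ), φ ε ≤ dirichletForm π K g := by
    have hB' : (0 : ℝ) < 1 / B := by positivity
    filter_upwards [Ioo_mem_nhdsGT hB'] with ε hε
    exact key ε hε.1 hε.2
  exact le_of_tendsto hlim hev

/-- **PROPOSITION 3.5 / 3.6 (`ρ₀ ≤ λ₁`): `ρ₀ ≤ λ`** — the modified log-Sobolev constant is at most the
variational spectral gap `spectralGapR π K = inf{𝓔(g,g) : π(g) = 0, ‖g‖_π = 1}`, for any finite chain
`K ≥ 0` with a positive probability vector `π`.  (On a one-point space both are the junk value `0`.)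
[cite: BobkovTetali2006, §3 Proposition 3.5 and Proposition 3.6] -/
theorem modLogSobolevConst_le_spectralGapR {π : X → ℝ} (hπ : ∀ x, 0 < π x) (hπ1 : ∑ x, π x = 1)
    {K : Matrix X X ℝ} (hK : ∀ x y, 0 ≤ K x y) :
    modLogSobolevConst π K ≤ spectralGapR π K := by
  classical
  by_cases hS : ({f : X → ℝ | ∑ x, π x * f x = 0 ∧ piInner π f f = 1} : Set (X → ℝ)).Nonempty
  · obtain ⟨f₀, hf₀⟩ := hS
    refine le_csInf ⟨_, ⟨f₀, hf₀, rfl⟩⟩ ?_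
    rintro _ ⟨g, ⟨hg0, hg1⟩, rfl⟩
    exact modLogSobolevConst_le_dirichletForm hπ hπ1 hK hg0 hg1
  · -- no admissible function: one point, every positive `f` is constant, `Ent_π(f) = 0`, `ρ₀ = λ = 0`
    have hempty : ({f : X → ℝ | ∑ x, π x * f x = 0 ∧ piInner π f f = 1} : Set (X → ℝ)) = ∅ :=
      Set.not_nonempty_iff_eq_empty.1 hS
    have hsub : ∀ a b : X, a = b := by
      intro a b
      by_contra hab
      apply hS
      haveI : Nontrivial X := ⟨⟨a, b, hab⟩⟩
      -- an admissible function exists on two points (as in Lemma 2.2.2)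
      have hX : ∃ S : Finset X, 0 < ∑ x ∈ S, π x ∧ ∑ x ∈ S, π x ≤ 1 / 2 := by
        by_cases ha : π a ≤ 1 / 2
        · exact ⟨{a}, by rw [sum_singleton]; exact hπ a, by rw [sum_singleton]; exact ha⟩
        · refine ⟨{b}, by rw [sum_singleton]; exact hπ b, ?_⟩
          rw [sum_singleton]
          have h2 : π a + π b ≤ ∑ x, π x := by
            rw [← sum_pair hab]
            exact sum_le_sum_of_subset_of_nonneg (subset_univ _) fun x _ _ => (hπ x).le
          push Not at ha
          linarith
      exact exists_mean_zero_piInner_one hπ1 hX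
    have hne : (univ : Finset X).Nonempty := by
      by_contra h
      rw [not_nonempty_iff_eq_empty] at h
      have : ∑ x, π x = 0 := by rw [h, sum_empty]
      linarith
    obtain ⟨x₀, -⟩ := hne
    have hconst : ∀ f : X → ℝ, piEnt π f = 0 := by
      intro f
      have e : f = fun _ => f x₀ := funext fun x => by rw [hsub x x₀]
      rw [e]
      unfold piEnt
      rw [← sum_mul, ← sum_mul, hπ1, one_mul, one_mul, sub_self]
    have hρset : ({f : X → ℝ | (∀ x, 0 < f x) ∧ piEnt π f ≠ 0} : Set (X → ℝ)) = ∅ :=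
      Set.eq_empty_iff_forall_notMem.2 fun f hf => hf.2 (hconst f)
    unfold modLogSobolevConst spectralGapR
    rw [hρset, hempty, Set.image_empty, Set.image_empty, Real.sInf_empty]

/-- **The sandwich `2α ≤ ρ₀ ≤ λ`** (`|X| ≥ 2`). [cite: BobkovTetali2006, §3 Proposition 3.6
(`0 ≤ ρ ≤ ρ₀ ≤ ρ₁ ≤ ρ₂ ≤ λ₁`)] -/
theorem BobkovTetali2006_prop_3_6 [Nontrivial X] {π : X → ℝ} (hπ : ∀ x, 0 < π x)
    (hπ1 : ∑ x, π x = 1) {K : Matrix X X ℝ} (hK : ∀ x y, 0 ≤ K x y) :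
    2 * logSobolevConst π K ≤ modLogSobolevConst π K
      ∧ modLogSobolevConst π K ≤ spectralGapR π K :=
  ⟨two_mul_logSobolevConst_le_modLogSobolevConst hπ hπ1 hK,
    modLogSobolevConst_le_spectralGapR hπ hπ1 hK⟩

/-- **The symmetric two-point space has `ρ₀ = 1` (= `λ₁ = a + b` of Example 3.9 with `a = b = ½`,
twice its `α = ½`)**: `1 = 2α ≤ ρ₀ ≤ λ ≤ 𝓔(f,f) = 1` at `f = (1, −1)`. [cite: BobkovTetali2006, §3
Example 3.9 (`(a+b)/2 ≤ ρ₀ ≤ … ≤ λ₁ = a + b`) with §1 p. 292 ("as in the symmetric two-point space …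
`ρ₀ = λ₁`")] [cite: Saloffcoste1997, §2.2.2 Theorem 2.2.8 (`α_{1/2} = 1/2`)] -/
theorem modLogSobolevConst_twoPoint : modLogSobolevConst twoPointPi twoPointKernel = 1 := by
  have hπ : ∀ x, 0 < twoPointPi x := fun x => by simp
  have hπ1 : ∑ x, twoPointPi x = 1 := by norm_num [Fin.sum_univ_two]
  have hK : ∀ x y, 0 ≤ twoPointKernel x y := fun x y => by simp
  refine le_antisymm ?_ ?_
  · -- `ρ₀ ≤ λ ≤ 𝓔(f) = 1`, `f = (1, −1)`
    have h1 := modLogSobolevConst_le_spectralGapR hπ hπ1 hK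
    set f : Fin 2 → ℝ := ![1, -1] with hf
    have hf0 : ∑ x, twoPointPi x * f x = 0 := by simp [Fin.sum_univ_two, hf]
    have hf1 : piInner twoPointPi f f = 1 := by rw [piInner_twoPoint]; norm_num [hf]
    have h2 := spectralGapR_le_dirichletForm (fun x => (hπ x).le) hK hf0 hf1
    rw [dirichletForm_twoPoint] at h2
    simp [hf] at h2
    linarith
  · have h := two_mul_logSobolevConst_le_modLogSobolevConst hπ hπ1 hK
    rw [Saloffcoste1997_thm_2_2_8_half] at h
    linarith

end Literature.Probability.MarkovChains
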